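import Summits.BirchSwinnertonDyer.BirchSwinnertonDyer.Theorems.GoldfeldGoodTwistsHalfHalf
import Literature.NumberTheory.EllipticCurves.BSDSelmerSmithProofs
import Literature.NumberTheory.EllipticCurves.ComplexMultiplication
import HarnessLib

/-!
# Route `TwoAdicConverse` (rung S3), crux `GoodOrdinaryRankZeroTwoConverse`: the «a.e. twist» form of
# the rank-`0` `2`-converse IS the even half of Goldfeld — an honesty theorem for the tribunal

Cell `bsd-2adic` (run/shared/lean/pub/bsd-2adic/), seat `bsd-2adic-conv-1`. THEOREMS ONLY — no named
fact, no axiom, no definition. Companion of `Theorems/TwoAdicConverseGoodTwists.lean` (crux ⟹ even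
half of Goldfeld with BSD in the good family).

For an elliptic curve `W / ℚ` (NO CM / reduction / minimality hypothesis) and the good family
`𝓕 = {d squarefree : d ≡ 1 (mod 4)}`, write `Q(d) :⟺ corank_{ℤ_2} Sel_{2^∞}(W^{(d)}/ℚ) = 0` and
`P(d) :⟺ ord_{s=1} L(W^{(d)}, s) = 0`. Kato's finiteness theorem at `p = 2` (Cor. 14.3, printed for
every `p`: `L(E,1) ≠ 0 ⇒ Sel_{2^∞}(E/ℚ)` finite) gives `P ⇒ Q` twist by twist; the rank-`0`
`2`-CONVERSE is `Q ⇒ P`. Smith's Thm. 1.1 + Monsky's `2`-parity + root-number equidistribution in `𝓕`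
(Modularity) give: `Q` holds for EXACTLY half of `𝓕` (`tendsto_familyProportion_selmerCorankTwoInfty_eq_zero`).

**Main statement** (`tendsto_familyProportion_twoConverse_iff_analyticRankZero_half`): under those
named facts,

  «the rank-`0` `2`-converse `Q ⇒ P` holds for `100 %` of `d ∈ 𝓕`»  ⟺  «`P` (analytic rank `0`)
  holds for exactly `50 %` of `d ∈ 𝓕`» (the even half of Goldfeld's conjecture for `W` on `𝓕`,
  analytic form).

So the director's «S3 rank statement for a.e. good-ordinary-at-`2` `E`» (D-0074 (A), seat conv-1),
read as a statement about almost every good twist of a FIXED curve, is not cheaper than — it is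
EQUIVALENT to — even-parity Goldfeld for that curve; the class-wide crux (item
stmt-BirchSwinnertonDyer-19218) implies it (companion file, `tendsto_familyProportion_rankZero`), and
nothing short of a `50 %` non-vanishing theorem for `L(W^{(d)}, 1)` in `𝓕` can replace the crux on
the density-one scale. Elementary bookkeeping in `𝓕` (§1): if `P ⇒ Q` and both have the same
relative density then `Q ∖ P` is negligible (`tendsto_familyProportion_imp_one`).

HONEST FRAMING: nothing here proves the crux or Goldfeld; every deep input (Kato 14.3@2, analytic
continuation, Monsky, Modularity, Smith Thm. 1.1 for `W`) is a named fact taken as a hypothesis.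
PARTITION (D-0054): none — RANK axis (S3); companion formula cell X5@2 good-ord (B1·O1), owner
bsd-2adic; a tribunal-facing strength statement (BC5), not a partition result.

References: A. Smith, arXiv:2503.17619 (2025), Thm. 1.1, Cor. 1.2–1.3 [arXiv250317619]; K. Kato,
Astérisque 295 (2004), Cor. 14.3 [Kato2004Asterisque]; D. Goldfeld, LNM 751 (1979);
T. Dokchitser, V. Dokchitser, Ann. of Math. 172 (2010), Thm. 1.4 [DokchitserDokchitserAnnals2010];
M. R. Murty, V. K. Murty (1997), Ch. 6 §1 [MurtyMurty1997]; BCDT, JAMS 14 (2001), Thm. A [BCDTJAMS2001].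
-/

set_option linter.dupNamespace false
set_option autoImplicit false

noncomputable section

open scoped Classical

open Filter Topology WeierstrassCurve Literature.NumberTheory.EllipticCurves
  Literature.NumberTheory.EllipticCurves.ModularForms
  Summit.BirchSwinnertonDyer.BirchSwinnertonDyer.Theorems.GoldfeldGoodTwists

namespace Summit.BirchSwinnertonDyer.BirchSwinnertonDyer.Theorems.TwoAdicGoodTwists

/-! ## §1 Bookkeeping in `𝓕`: a sub-predicate of the same density exhausts -/

/-- `#{d ∈ 𝓕 : Q d} = #{d ∈ 𝓕 : P d} + #{d ∈ 𝓕 : Q d ∧ ¬ P d}` when `P ⇒ Q` on `𝓕`. [folklore] -/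
theorem natCard_family_eq_add_of_imp {P Q : ℤ → Prop}
    (hPQ : ∀ d, Squarefree d → d % 4 = 1 → P d → Q d) (X : ℕ) :
    Nat.card {d : ℤ | Squarefree d ∧ |d| ≤ (X : ℤ) ∧ (d % 4 = 1 ∧ Q d)} =
      Nat.card {d : ℤ | Squarefree d ∧ |d| ≤ (X : ℤ) ∧ (d % 4 = 1 ∧ P d)} +
        Nat.card {d : ℤ | Squarefree d ∧ |d| ≤ (X : ℤ) ∧ (d % 4 = 1 ∧ (Q d ∧ ¬ P d))} := by
  rw [Nat.card_coe_set_eq, Nat.card_coe_set_eq, Nat.card_coe_set_eq,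
    ← Set.ncard_union_eq (Set.disjoint_left.mpr fun _ hd hd' ↦ hd'.2.2.2.2 hd.2.2.2)
      (finite_setOf_squarefree _ X) (finite_setOf_squarefree _ X)]
  congr 1
  ext d
  simp only [Set.mem_union, Set.mem_setOf_eq]
  constructor
  · rintro ⟨hsq, hX, h4, hQ⟩
    by_cases hP : P d
    · exact Or.inl ⟨hsq, hX, h4, hP⟩
    · exact Or.inr ⟨hsq, hX, h4, hQ, hP⟩
  · rintro (⟨hsq, hX, h4, hP⟩ | ⟨hsq, hX, h4, hQ, -⟩)
    · exact ⟨hsq, hX, h4, hPQ d hsq h4 hP⟩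
    · exact ⟨hsq, hX, h4, hQ⟩

/-- If `P ⇒ Q` on `𝓕` and `P`, `Q` have the same relative density `δ` in `𝓕`, then `Q ∖ P` has
relative density `0` in `𝓕`. [folklore] -/
theorem tendsto_familyProportion_sdiff_zero {P Q : ℤ → Prop} {δ : ℝ}
    (hPQ : ∀ d, Squarefree d → d % 4 = 1 → P d → Q d)
    (hP : Tendsto (fun X : ℕ ↦ (Nat.card {d : ℤ | Squarefree d ∧ |d| ≤ (X : ℤ) ∧
      (d % 4 = 1 ∧ P d)} : ℝ) / Nat.card {d : ℤ | Squarefree d ∧ |d| ≤ (X : ℤ) ∧ d % 4 = 1})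
      atTop (𝓝 δ))
    (hQ : Tendsto (fun X : ℕ ↦ (Nat.card {d : ℤ | Squarefree d ∧ |d| ≤ (X : ℤ) ∧
      (d % 4 = 1 ∧ Q d)} : ℝ) / Nat.card {d : ℤ | Squarefree d ∧ |d| ≤ (X : ℤ) ∧ d % 4 = 1})
      atTop (𝓝 δ)) :
    Tendsto (fun X : ℕ ↦ (Nat.card {d : ℤ | Squarefree d ∧ |d| ≤ (X : ℤ) ∧
      (d % 4 = 1 ∧ (Q d ∧ ¬ P d))} : ℝ) / Nat.card {d : ℤ | Squarefree d ∧ |d| ≤ (X : ℤ) ∧ d % 4 = 1})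
      atTop (𝓝 0) := by
  have h := hQ.sub hP
  rw [sub_self] at h
  refine h.congr fun X ↦ ?_
  have hc : (Nat.card {d : ℤ | Squarefree d ∧ |d| ≤ (X : ℤ) ∧ (d % 4 = 1 ∧ Q d)} : ℝ) =
      Nat.card {d : ℤ | Squarefree d ∧ |d| ≤ (X : ℤ) ∧ (d % 4 = 1 ∧ P d)} +
        Nat.card {d : ℤ | Squarefree d ∧ |d| ≤ (X : ℤ) ∧ (d % 4 = 1 ∧ (Q d ∧ ¬ P d))} := by
    exact_mod_cast natCard_family_eq_add_of_imp hPQ X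
  rw [hc, add_div, add_sub_cancel_left]

/-- If `P ⇒ Q` on `𝓕` and `P`, `Q` have the same relative density `δ` in `𝓕`, then the
implication `Q ⇒ P` holds for `100 %` of `d ∈ 𝓕`. [folklore] -/
theorem tendsto_familyProportion_imp_one {P Q : ℤ → Prop} {δ : ℝ}
    (hPQ : ∀ d, Squarefree d → d % 4 = 1 → P d → Q d)
    (hP : Tendsto (fun X : ℕ ↦ (Nat.card {d : ℤ | Squarefree d ∧ |d| ≤ (X : ℤ) ∧
      (d % 4 = 1 ∧ P d)} : ℝ) / Nat.card {d : ℤ | Squarefree d ∧ |d| ≤ (X : ℤ) ∧ d % 4 = 1})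
      atTop (𝓝 δ))
    (hQ : Tendsto (fun X : ℕ ↦ (Nat.card {d : ℤ | Squarefree d ∧ |d| ≤ (X : ℤ) ∧
      (d % 4 = 1 ∧ Q d)} : ℝ) / Nat.card {d : ℤ | Squarefree d ∧ |d| ≤ (X : ℤ) ∧ d % 4 = 1})
      atTop (𝓝 δ)) :
    Tendsto (fun X : ℕ ↦ (Nat.card {d : ℤ | Squarefree d ∧ |d| ≤ (X : ℤ) ∧
      (d % 4 = 1 ∧ (Q d → P d))} : ℝ) / Nat.card {d : ℤ | Squarefree d ∧ |d| ≤ (X : ℤ) ∧ d % 4 = 1})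
      atTop (𝓝 1) := by
  have h := tendsto_familyProportion_compl (tendsto_familyProportion_sdiff_zero hPQ hP hQ)
  rw [sub_zero] at h
  rw [familyProportion_congr (Q := fun d ↦ Q d → P d) (fun d _ _ ↦ ?_)] at h
  · exact h
  · simp only [not_and, not_not]

/-! ## §2 The density of `{corank_{ℤ_2} Sel_{2^∞}(W^{(d)}) = 0}` in `𝓕` is `1/2` -/

section Density

variable (W : WeierstrassCurve ℚ) [W.IsElliptic]

/-- **Kato at `2`, twist by twist: analytic rank `0` ⟹ Selmer corank `0`.** For `d ≠ 0`:
`ord_{s=1} L(W^{(d)}, s) = 0 ⟹ L(W^{(d)}, 1) ≠ 0` (analytic continuation, `hE`) `⟹ Sel_{2^∞}(W^{(d)}/ℚ)`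
finite (Kato Cor. 14.3 at `p = 2`, `hKato`) `⟹ corank_{ℤ_2} Sel_{2^∞}(W^{(d)}) = 0`.
[cite: Kato2004Asterisque, Cor. 14.3] [cite: BCDTJAMS2001, Thm. A] -/
theorem selmerCorankTwoInfty_eq_zero_of_analyticRank_eq_zero
    (hKato : ∀ (V : WeierstrassCurve ℚ) [V.IsElliptic], kato_finite_of_L_one_ne_zero V 2)
    (hE : hasEntireLFunction_rat) {d : ℤ} (hd0 : d ≠ 0)
    (h : (W.quadraticTwist d).analyticRank = 0) : selmerCorankTwoInfty (W.quadraticTwist d) = 0 := by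
  have hd0' : ((d : ℤ) : ℚ) ≠ 0 := by exact_mod_cast hd0
  haveI := W.isElliptic_quadraticTwist hd0'
  have hL : (W.quadraticTwist (d : ℚ)).entireLFunction 1 ≠ 0 :=
    (analyticRank_eq_zero_iff_L_one_ne_zero_of_hasEntireLFunction_rat hE _).mp h
  haveI : Finite ((W.quadraticTwist (d : ℚ)).selmerGroupPInfty 2) := (hKato _ hL).2.2
  rw [selmerCorankTwoInfty_eq]
  exact (finite_selmerGroupPInfty_iff_selmerCorank_eq_zero _ 2).mp inferInstance

/-- **`corank_{ℤ_2} Sel_{2^∞}(W^{(d)}) = 0` for exactly half of `d ∈ 𝓕`.** From Smith's Thm. 1.1 for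
`W` (`hS`: `{corank ≤ 1}` has density `1`, hence relative density `1` in `𝓕`), `2`-parity
`(−1)^{corank} = w` (`hpar`, Monsky) and the root-number equidistribution in `𝓕` (Modularity,
`GoldfeldGoodTwists.tendsto_familyProportion_rootNumber_eq_one`): on `{corank ≤ 1}`,
`corank = 0 ↔ w = +1`. [cite: arXiv250317619, Thm. 1.1] [cite: DokchitserDokchitserAnnals2010, Thm. 1.4]
[cite: MurtyMurty1997, Ch. 6 §1] -/
theorem tendsto_familyProportion_selmerCorankTwoInfty_eq_zero
    (hpar : ∀ (E : WeierstrassCurve ℚ) [E.IsElliptic], p_parity E 2) (hmod : exists_isNewformOf)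
    (hS : smith_selmerCorank_density W) :
    Tendsto (fun X : ℕ ↦ (Nat.card {d : ℤ | Squarefree d ∧ |d| ≤ (X : ℤ) ∧ (d % 4 = 1 ∧
        (d ≠ 0 ∧ selmerCorankTwoInfty (W.quadraticTwist d) = 0))} : ℝ) /
      Nat.card {d : ℤ | Squarefree d ∧ |d| ≤ (X : ℤ) ∧ d % 4 = 1}) atTop (𝓝 (1 / 2)) := by
  have hR := twistDensity_selmerCorankTwoInfty_le_one_of W hS
  have h0 : twistDensity (fun d ↦ ¬ (d ≠ 0 ∧ selmerCorankTwoInfty (W.quadraticTwist d) ≤ 1)) 0 := by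
    simpa using hR.compl
  have hRF : Tendsto (fun X : ℕ ↦ (Nat.card {d : ℤ | Squarefree d ∧ |d| ≤ (X : ℤ) ∧ (d % 4 = 1 ∧
        (d ≠ 0 ∧ selmerCorankTwoInfty (W.quadraticTwist d) ≤ 1))} : ℝ) /
      Nat.card {d : ℤ | Squarefree d ∧ |d| ≤ (X : ℤ) ∧ d % 4 = 1}) atTop (𝓝 1) :=
    tendsto_familyProportion_one_of_twistDensity_zero (h0.mono_zero fun d _ h hRd ↦ h.2 hRd)
  refine tendsto_familyProportion_of_congr_one (tendsto_familyProportion_rootNumber_eq_one W hmod)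
    hRF fun d hd _ hRd ↦ ?_
  haveI := W.isElliptic_quadraticTwist (d := (d : ℚ)) (by exact_mod_cast hd.ne_zero)
  have h2 : (-1 : ℤ) ^ (W.quadraticTwist (d : ℚ)).selmerCorank 2 =
      (W.quadraticTwist (d : ℚ)).rootNumber := hpar _
  rw [← selmerCorankTwoInfty_eq] at h2
  constructor
  · intro hw
    rw [hw] at h2
    have hc1 : selmerCorankTwoInfty (W.quadraticTwist (d : ℚ)) ≠ 1 := fun h1 ↦ by
      rw [h1] at h2
      norm_num at h2
    exact ⟨hRd.1, by omega⟩
  · rintro ⟨-, hc⟩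
    rw [hc] at h2
    simpa using h2.symm

/-! ## §3 The equivalence -/

/-- **The «almost every good twist» form of the rank-`0` `2`-converse is EQUIVALENT to the even half
of Goldfeld (analytic form) for `W` on `𝓕`.** For an elliptic `W / ℚ`, under Kato's Cor. 14.3 at
`2` (`hKato`), analytic continuation (`hE`), `2`-parity (`hpar`), Modularity (`hmod`) and Smith's
Thm. 1.1 for `W` (`hS`):
«for `100 %` of `d ∈ 𝓕`: `corank_{ℤ_2} Sel_{2^∞}(W^{(d)}) = 0 ⟹ ord_{s=1} L(W^{(d)}, s) = 0`»
`⟺` «`ord_{s=1} L(W^{(d)}, s) = 0` for exactly `50 %` of `d ∈ 𝓕`».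
(⇒) `{r_an = 0} = {corank = 0} ∩ {converse}` (Kato gives `⊇`), of relative density `1/2 · 1`;
(⇐) `{r_an = 0} ⊂ {corank = 0}` (Kato), both of relative density `1/2`, so the difference — the
failure set of the converse — is negligible (§1). [cite: arXiv250317619, Thm. 1.1 and Cor. 1.2]
[cite: Kato2004Asterisque, Cor. 14.3] [cite: DokchitserDokchitserAnnals2010, Thm. 1.4]
[cite: MurtyMurty1997, Ch. 6 §1] -/
theorem tendsto_familyProportion_twoConverse_iff_analyticRankZero_half
    (hKato : ∀ (V : WeierstrassCurve ℚ) [V.IsElliptic], kato_finite_of_L_one_ne_zero V 2)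
    (hE : hasEntireLFunction_rat)
    (hpar : ∀ (E : WeierstrassCurve ℚ) [E.IsElliptic], p_parity E 2) (hmod : exists_isNewformOf)
    (hS : smith_selmerCorank_density W) :
    Tendsto (fun X : ℕ ↦ (Nat.card {d : ℤ | Squarefree d ∧ |d| ≤ (X : ℤ) ∧ (d % 4 = 1 ∧
        (d ≠ 0 → selmerCorankTwoInfty (W.quadraticTwist d) = 0 →
          (W.quadraticTwist d).analyticRank = 0))} : ℝ) /
      Nat.card {d : ℤ | Squarefree d ∧ |d| ≤ (X : ℤ) ∧ d % 4 = 1}) atTop (𝓝 1) ↔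
    Tendsto (fun X : ℕ ↦ (Nat.card {d : ℤ | Squarefree d ∧ |d| ≤ (X : ℤ) ∧ (d % 4 = 1 ∧
        (W.quadraticTwist d).analyticRank = 0)} : ℝ) /
      Nat.card {d : ℤ | Squarefree d ∧ |d| ≤ (X : ℤ) ∧ d % 4 = 1}) atTop (𝓝 (1 / 2)) := by
  have hQ := tendsto_familyProportion_selmerCorankTwoInfty_eq_zero W hpar hmod hS
  -- `P ⇒ Q` on `𝓕` (Kato at `2`)
  have hPQ : ∀ d : ℤ, Squarefree d → d % 4 = 1 → (W.quadraticTwist d).analyticRank = 0 →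
      (d ≠ 0 ∧ selmerCorankTwoInfty (W.quadraticTwist d) = 0) := fun d hd _ h ↦
    ⟨hd.ne_zero, selmerCorankTwoInfty_eq_zero_of_analyticRank_eq_zero W hKato hE hd.ne_zero h⟩
  constructor
  · -- (⇒): `P = Q ∧ (Q → P)` pointwise
    intro hconv
    have hconv' : Tendsto (fun X : ℕ ↦ (Nat.card {d : ℤ | Squarefree d ∧ |d| ≤ (X : ℤ) ∧ (d % 4 = 1 ∧
        ((d ≠ 0 ∧ selmerCorankTwoInfty (W.quadraticTwist d) = 0) →
          (W.quadraticTwist d).analyticRank = 0))} : ℝ) /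
        Nat.card {d : ℤ | Squarefree d ∧ |d| ≤ (X : ℤ) ∧ d % 4 = 1}) atTop (𝓝 1) := by
      rw [familyProportion_congr (Q := fun d ↦ d ≠ 0 → selmerCorankTwoInfty (W.quadraticTwist d) = 0 →
        (W.quadraticTwist d).analyticRank = 0) (fun d _ _ ↦ by tauto)]
      exact hconv
    have h := tendsto_familyProportion_and_one hQ hconv'
    rw [familyProportion_congr (Q := fun d ↦ (W.quadraticTwist d).analyticRank = 0)
      (fun d hd h4 ↦ ?_)] at h
    · exact h
    · constructor
      · rintro ⟨hq, hqp⟩; exact hqp hq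
      · intro hp; exact ⟨hPQ d hd h4 hp, fun _ ↦ hp⟩
  · -- (⇐): `P ⊂ Q` with equal densities `1/2`
    intro hP
    have h := tendsto_familyProportion_imp_one hPQ hP hQ
    rw [familyProportion_congr (Q := fun d ↦ d ≠ 0 → selmerCorankTwoInfty (W.quadraticTwist d) = 0 →
        (W.quadraticTwist d).analyticRank = 0) (fun d _ _ ↦ by tauto)] at h
    exact h

/-- **Corollary: a POINTWISE rank-`0` `2`-converse on the good twists of `W` gives the even half of
Goldfeld (analytic form) for `W` on `𝓕`.** If `corank_{ℤ_2} Sel_{2^∞}(W^{(d)}) = 0 ⟹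
ord_{s=1} L(W^{(d)}, s) = 0` for every squarefree `d ≡ 1 (mod 4)` (`hConvF` — for `W` non-CM,
globally minimal and good ordinary at `2` this is the crux `GoodOrdinaryRankZeroTwoConverse`, item
stmt-BirchSwinnertonDyer-19218, transported to the minimal models of the twists:
`TwoAdicGoodTwists.rankZero_bsd_quadraticTwist_of_selmerCorankTwoInfty_eq_zero` of the companion
file), then `ord_{s=1} L(W^{(d)}, s) = 0` for exactly `50 %` of `d ∈ 𝓕`.
[cite: arXiv250317619, Thm. 1.1 and Cor. 1.2] [cite: Kato2004Asterisque, Cor. 14.3] -/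
theorem tendsto_familyProportion_analyticRankZero_half_of_pointwise
    (hKato : ∀ (V : WeierstrassCurve ℚ) [V.IsElliptic], kato_finite_of_L_one_ne_zero V 2)
    (hE : hasEntireLFunction_rat)
    (hpar : ∀ (E : WeierstrassCurve ℚ) [E.IsElliptic], p_parity E 2) (hmod : exists_isNewformOf)
    (hS : smith_selmerCorank_density W)
    (hConvF : ∀ d : ℤ, Squarefree d → d % 4 = 1 →
      selmerCorankTwoInfty (W.quadraticTwist d) = 0 → (W.quadraticTwist d).analyticRank = 0) :
    Tendsto (fun X : ℕ ↦ (Nat.card {d : ℤ | Squarefree d ∧ |d| ≤ (X : ℤ) ∧ (d % 4 = 1 ∧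
        (W.quadraticTwist d).analyticRank = 0)} : ℝ) /
      Nat.card {d : ℤ | Squarefree d ∧ |d| ≤ (X : ℤ) ∧ d % 4 = 1}) atTop (𝓝 (1 / 2)) := by
  refine (tendsto_familyProportion_twoConverse_iff_analyticRankZero_half W hKato hE hpar hmod hS).mp ?_
  have hall : (fun X : ℕ ↦ (Nat.card {d : ℤ | Squarefree d ∧ |d| ≤ (X : ℤ) ∧ (d % 4 = 1 ∧
        (d ≠ 0 → selmerCorankTwoInfty (W.quadraticTwist d) = 0 →
          (W.quadraticTwist d).analyticRank = 0))} : ℝ) /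
      Nat.card {d : ℤ | Squarefree d ∧ |d| ≤ (X : ℤ) ∧ d % 4 = 1}) =
      fun X : ℕ ↦ (Nat.card {d : ℤ | Squarefree d ∧ |d| ≤ (X : ℤ) ∧ (d % 4 = 1 ∧ True)} : ℝ) /
        Nat.card {d : ℤ | Squarefree d ∧ |d| ≤ (X : ℤ) ∧ d % 4 = 1} :=
    familyProportion_congr fun d hd h4 ↦ ⟨fun _ ↦ trivial, fun _ _ h0 ↦ hConvF d hd h4 h0⟩
  rw [hall]
  simp only [and_true]
  refine tendsto_const_nhds.congr' ?_
  filter_upwards [eventually_ge_atTop 1] with X hX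
  rw [div_self (natCard_emod_four_pos hX).ne']

end Density

end Summit.BirchSwinnertonDyer.BirchSwinnertonDyer.Theorems.TwoAdicGoodTwists

end
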